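import Summits.Langlands.Langlands.Theses.IrreducibilityBySelfDuality
import Literature.NumberTheory.Automorphic.SelfdualGL3AdjointLiftProofs
import Literature.NumberTheory.Automorphic.ReciprocityGLnRankOneProofs

/-!
# `RegularAdjointLiftCM` — negative lane: the kill criterion, kernel-checked

Refuter-side support for the crux `RegularAdjointLiftCM` (item stmt-Langlands-13617, route
`route-Langlands-IrreducibilityBySelfDuality`).  No statement of the route is proved or refuted here;
these are the helper lemmas behind the standing disprover's `Cruxes/RegularAdjointLiftCM/Disproof.lean`
§4b, landed so that ideators, triagers and planners can IMPORT them.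

* `exists_heckeCharacter_satake_eq` — the GL(1) dictionary pointwise: the Satake values `{d_v}` of a
  cuspidal GL(1) Borel–Jacquet datum are the values at uniformizers of ONE Hecke character (assembled
  from the proved tree lemmas `exists_heckeCharacter_glOne`, `isUnramifiedAt_heckeCharacter_glOne`,
  `exists_eq_singleton_of_hasSatakeParamAt_glOne`, `localComponent_eq_valueAtUniformizer`).
* `adParams_map_mul` — `Ad(c · β) = Ad(β)`: the adjoint Satake parameter is blind to twists.
* `no_regular_descent` — granted multiplicity one for `SL(2)` (the named fact
  `Ramakrishnan2000_multiplicityOneSL2`, through the proved `unique_up_to_twist`): if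
  `t_π = ν₀ · Ad(t_{σ₀})` a.e. for a cuspidal `σ₀` on `GL₂` none of whose a.e. Satake twists by Hecke
  characters is regular algebraic, then NO regular algebraic cuspidal `σ` and GL(1) datum `ν` satisfy
  `t_π = ν · Ad(t_σ)` a.e. (the relation of the crux's conclusion, verbatim).
* `regularAdjointLiftCM_false_of_witness` — THE KILL CRITERION: multiplicity one for `SL(2)` + the
  input item `SelfdualGL3AdjointLift` (Ramakrishnan 2014 Thm A) + ONE regular algebraic, essentially
  self-dual cuspidal `π` on `GL₃` over a CM field with a descent `σ₀` admitting no regular algebraic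
  Satake twist ⇒ `¬ RegularAdjointLiftCM`.  The disprover's analysis (Disproof.lean §6: Weil's unit
  criterion over a CM field, `NumberField.IsCMField.indexRealUnits_eq_one_or_two`) says such a `π`
  should NOT exist — this lemma is the precise target a counterexample hunter must hit, not a held
  negative lemma; over a totally real or a non-CM totally complex field the analogous witnesses DO
  exist on paper (non-paritious Hilbert newforms; Patrikis 2019 Lemma 2.1.5), which is why
  `IsCMField` is load-bearing.
-/

open scoped BigOperators Topology Classical
open Filter Set Function IsDedekindDomain NumberField
open Literature.NumberTheory.Automorphic
open Literature.NumberTheory.GaloisRepresentations (HeckeCharacter)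

noncomputable section

namespace Summit.Langlands.Langlands.Theorems.RegularAdjointLiftCM.Negative

open Summit.Langlands.Langlands.Theses.IrreducibilityBySelfDuality

/-- Rankin–Selberg data are blind to a common twist: `{(ca)(cb)⁻¹} = {ab⁻¹}` (`c ≠ 0`). [folklore] -/
theorem rsData_map_mul (s t : Multiset ℂ) {c : ℂ} (hc : c ≠ 0) :
    rsData (s.map (c * ·)) (t.map (c * ·)) = rsData s t := by
  induction s using Multiset.induction_on with
  | empty => simp [rsData_zero]
  | cons a s ih =>
      rw [Multiset.map_cons, rsData_cons, rsData_cons, ih, Multiset.map_map]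
      congr 1
      refine Multiset.map_congr rfl fun y _ => ?_
      simp only [Function.comp_apply]
      rw [mul_inv, mul_mul_mul_comm, mul_inv_cancel₀ hc, one_mul]

/-- **`Ad` is twist-invariant**: `Ad(c · β) = Ad(β)` for `c ≠ 0` — the unramified shadow of
`Ad(σ ⊗ χ) = Ad(σ)`. [folklore] -/
theorem adParams_map_mul (β : Multiset ℂ) {c : ℂ} (hc : c ≠ 0) :
    adParams (β.map (c * ·)) = adParams β := by
  change (rsData _ _).erase 1 = (rsData _ _).erase 1
  rw [rsData_map_mul β β hc]

variable {F : Type} [Field F] [NumberField F] {hF1 : isCompact_glFiniteIntegralLevel 1 F}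
  {hF2 : isCompact_glFiniteIntegralLevel 2 F} {hF3 : isCompact_glFiniteIntegralLevel 3 F}

/-- **GL(1) dictionary, pointwise**: the Satake values of a cuspidal GL(1) datum `ν` are the values
at uniformizers of its Hecke character (Borel–Jacquet 1979, 4.6: automorphic representations of
`GL(1)` are idèle class characters; tree lemmas `exists_heckeCharacter_glOne`,
`isUnramifiedAt_heckeCharacter_glOne`, `exists_eq_singleton_of_hasSatakeParamAt_glOne`,
`localComponent_eq_valueAtUniformizer`). [cite: BorelJacquetCorvallis1979, §4.6] -/
theorem exists_heckeCharacter_satake_eq (ν : CuspidalAutomorphicRepData 1 F hF1) :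
    ∃ θ : HeckeCharacter F, ∀ (v : HeightOneSpectrum (𝓞 F)) (d : ℂ),
      ν.1.HasSatakeParamAt v {d} → d = θ.valueAtUniformizer v := by
  obtain ⟨θ, hθ⟩ := ν.1.exists_heckeCharacter_glOne
  refine ⟨θ, fun v d hd => ?_⟩
  have hur : θ.IsUnramifiedAt v := ν.1.isUnramifiedAt_heckeCharacter_glOne hθ hd
  obtain ⟨ϖ, hϖ, hdϖ⟩ := ν.1.exists_eq_singleton_of_hasSatakeParamAt_glOne hθ hd
  rw [Multiset.singleton_inj.mp hdϖ, ← HeckeCharacter.localComponent_apply,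
    HeckeCharacter.localComponent_eq_valueAtUniformizer hur hϖ]

/-- **No regular descent from one bad descent** (multiplicity one for `SL(2)`, Ramakrishnan 2000
Thm 4.1.2, as the named fact `Ramakrishnan2000_multiplicityOneSL2` through the proved
`Ramakrishnan2014_selfdualGL3_adjointLift.unique_up_to_twist`).  If `t_π = ν₀ · Ad(t_{σ₀})` a.e.
for a cuspidal `σ₀` on `GL₂(𝔸_F)` none of whose a.e. Satake twists by Hecke characters is regular
algebraic, then there are NO regular algebraic cuspidal `σ` on `GL₂(𝔸_F)` and cuspidal GL(1) datum
`ν` with, a.e., `t_{π,v} = d_v · Ad(t_{σ,v})` (`{d_v}` the Satake parameter of `ν`) — the last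
clause of the conclusion of `RegularAdjointLiftCM`, verbatim.
[cite: Ramakrishnan2000, Theorem 4.1.2] [cite: Ramakrishnan2014, Theorem A] -/
theorem no_regular_descent (hM : Ramakrishnan2000_multiplicityOneSL2)
    (π : CuspidalAutomorphicRepData 3 F hF3) (σ₀ : CuspidalAutomorphicRepData 2 F hF2)
    (ν₀ : HeckeCharacter F)
    (had : ∀ᶠ v in cofinite, ∀ β : Multiset ℂ, σ₀.1.HasSatakeParamAt v β →
      π.1.HasSatakeParamAt v ((adParams β).map fun c => ν₀.valueAtUniformizer v * c))
    (hnp : ∀ (σ : CuspidalAutomorphicRepData 2 F hF2) (χ : HeckeCharacter F),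
      IsSatakeTwistBy σ₀.1 σ.1 χ → ¬ σ.1.IsRegularAlgebraic) :
    ¬ ∃ (σ : CuspidalAutomorphicRepData 2 F hF2) (ν : CuspidalAutomorphicRepData 1 F hF1),
        σ.1.IsRegularAlgebraic ∧
          ∀ᶠ v in cofinite, ∀ α β : Multiset ℂ, π.1.HasSatakeParamAt v α →
            σ.1.HasSatakeParamAt v β → ∃ d : ℂ, ν.1.HasSatakeParamAt v {d} ∧
              α = (((β ×ˢ β).map (fun p : ℂ × ℂ => p.1 * p.2⁻¹)).erase 1).map (fun c => d * c) := by
  rintro ⟨σ, ν, hσ, hrel⟩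
  obtain ⟨θ, hθ⟩ := exists_heckeCharacter_satake_eq ν
  have hrel' : ∀ᶠ v in cofinite, ∀ β : Multiset ℂ, σ.1.HasSatakeParamAt v β →
      π.1.HasSatakeParamAt v ((adParams β).map fun c => θ.valueAtUniformizer v * c) := by
    filter_upwards [hrel, π.1.hasSatakeParamAt_cofinite_holds] with v hv hπu β hβ
    obtain ⟨α, hα⟩ := hπu
    obtain ⟨d, hd, hαd⟩ := hv α β hα hβ
    rw [← hθ v d hd]
    change π.1.HasSatakeParamAt v
      ((((β ×ˢ β).map (fun p : ℂ × ℂ => p.1 * p.2⁻¹)).erase 1).map (fun c => d * c))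
    rw [← hαd]
    exact hα
  obtain ⟨χ, hχ⟩ := Ramakrishnan2014_selfdualGL3_adjointLift.unique_up_to_twist hM had hrel'
  exact hnp σ χ hχ hσ

/-- **The kill criterion for `RegularAdjointLiftCM`.**  Granted multiplicity one for `SL(2)` and the
input item `SelfdualGL3AdjointLift` (Ramakrishnan 2014 Thm A at Satake level), the crux is refuted by
ONE regular algebraic cuspidal `π` on `GL₃` over a CM field `F`, essentially self-dual at Satake level
(GL(1) witness `η`), having a descent `t_π = ν₀ · Ad(t_{σ₀})` a.e. NONE of whose a.e. Satake twists
`σ₀ ⊗ χ` is regular algebraic.  Over a CM field no such `π` is expected (Weil's unit criterion: the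
re-twisting character exists because `[𝓞_F^× : μ_F 𝓞_{F⁺}^×] ≤ 2`,
`NumberField.IsCMField.indexRealUnits_eq_one_or_two`); over totally real `F` (non-paritious Hilbert
newforms) and over non-CM totally complex `F` (Patrikis 2019, Lemma 2.1.5) the analogous `π` exist on
paper — which is exactly why the crux carries `IsCMField`.  This theorem settles nothing: it is the
target a counterexample must hit. [cite: Ramakrishnan2014, Theorem A and Corollary B]
[cite: Ramakrishnan2000, Theorem 4.1.2] [cite: Patrikis2019, Lemma 2.1.5 and Prop. 1.3.1] -/
theorem regularAdjointLiftCM_false_of_witness (hM : Ramakrishnan2000_multiplicityOneSL2)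
    (hA : SelfdualGL3AdjointLift) (hF : IsCMField F)
    (π : CuspidalAutomorphicRepData 3 F hF3) (η : CuspidalAutomorphicRepData 1 F hF1)
    (σ₀ : CuspidalAutomorphicRepData 2 F hF2) (ν₀ : HeckeCharacter F)
    (hπ : π.1.IsRegularAlgebraic)
    (hη : ∀ᶠ v in cofinite, ∀ α : Multiset ℂ, π.1.HasSatakeParamAt v α →
      ∃ e : ℂ, η.1.HasSatakeParamAt v {e} ∧ α.map (fun a => a⁻¹) = α.map (fun a => e * a))
    (had : ∀ᶠ v in cofinite, ∀ β : Multiset ℂ, σ₀.1.HasSatakeParamAt v β →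
      π.1.HasSatakeParamAt v ((adParams β).map fun c => ν₀.valueAtUniformizer v * c))
    (hnp : ∀ (σ : CuspidalAutomorphicRepData 2 F hF2) (χ : HeckeCharacter F),
      IsSatakeTwistBy σ₀.1 σ.1 χ → ¬ σ.1.IsRegularAlgebraic) :
    ¬ RegularAdjointLiftCM := fun h => by
  obtain ⟨σ, ν, hσ, -, -, hrel⟩ := h hA F hF hF1 hF2 hF3 π hπ ⟨η, hη⟩
  exact no_regular_descent hM π σ₀ ν₀ had hnp ⟨σ, ν, hσ, hrel⟩

/-- **Contrapositive bookkeeping**: the crux + Thm A + multiplicity one for `SL(2)` ⇒ EVERY descent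
`σ₀` of every regular algebraic essentially self-dual cuspidal `π` on `GL₃` over a CM field has a
regular algebraic a.e. Satake twist by a Hecke character — the form in which the sibling crux
`RegularTwistCM` states the archimedean content. [cite: Ramakrishnan2014, Corollary B (CM half)] -/
theorem descent_has_regular_twist (hM : Ramakrishnan2000_multiplicityOneSL2)
    (hA : SelfdualGL3AdjointLift) (h : RegularAdjointLiftCM) (hF : IsCMField F)
    (π : CuspidalAutomorphicRepData 3 F hF3) (η : CuspidalAutomorphicRepData 1 F hF1)
    (σ₀ : CuspidalAutomorphicRepData 2 F hF2) (ν₀ : HeckeCharacter F)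
    (hπ : π.1.IsRegularAlgebraic)
    (hη : ∀ᶠ v in cofinite, ∀ α : Multiset ℂ, π.1.HasSatakeParamAt v α →
      ∃ e : ℂ, η.1.HasSatakeParamAt v {e} ∧ α.map (fun a => a⁻¹) = α.map (fun a => e * a))
    (had : ∀ᶠ v in cofinite, ∀ β : Multiset ℂ, σ₀.1.HasSatakeParamAt v β →
      π.1.HasSatakeParamAt v ((adParams β).map fun c => ν₀.valueAtUniformizer v * c)) :
    ∃ (σ : CuspidalAutomorphicRepData 2 F hF2) (χ : HeckeCharacter F),
      IsSatakeTwistBy σ₀.1 σ.1 χ ∧ σ.1.IsRegularAlgebraic := by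
  by_contra hne
  exact regularAdjointLiftCM_false_of_witness hM hA hF π η σ₀ ν₀ hπ hη had
    (fun σ χ hχ hσ => hne ⟨σ, χ, hχ, hσ⟩) h

end Summit.Langlands.Langlands.Theorems.RegularAdjointLiftCM.Negative

end
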